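import Literature.Probability.LatticeModels.PairIsing
import Literature.Probability.LatticeModels.IsingThermodynamics
import Mathlib.Analysis.SpecialFunctions.Pow.Real
import HarnessLib

/-!
# Vocabulary of line `decimation-homotopy-rate` for crux `ExistsScaleCovariantLimit` (stmt-CriticalPhenomena-1981)

Route `HyperoctahedralRP` (sub-problem `CriticalPhenomena/Ising3DConformalLimit`), crux
`Summit.CriticalPhenomena.Ising3DConformalLimit.Theses.HyperoctahedralRP.ExistsScaleCovariantLimit` (item
stmt-CriticalPhenomena-1981, shared verbatim by 14 routes). This file is the **definitions module** of the checked
skeleton `Cruxes/ExistsScaleCovariantLimit/Lines/decimation_homotopy_rate.lean` (crux-plan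
`planner-cruxplan-stmt-CriticalPhenomena-1981-decimation-homotopy--0`; lead
`prover-line-stmt-CriticalPhenomena-1981-c8-0`, skeleton v2). It carries, sorry-free, the line's VOCABULARY
(§0: the two-coupling nearest-neighbour `K` + sublattice range-`p` `J` ferromagnet on the free boxes `Λ_N`, its
finite Gibbs averages `boxAvg`, the sublattice pair function `subPair`, the susceptibility critical curve `Jcrit`,
the finite-volume pinned sublattice zoom `finZoom` and the pinned zoom `latticeZoom` of the critical model at
integer meshes), the line's STATEMENTS (§1: `EndpointIdentity`, `BoxBridge`, `FreeBoxLimit`, `CurveEndpoints`,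
`PathLipschitz`, `NNEndTangentBound`) and the five stub STATEMENTS `Sig.stub_*` (§2, each a `def … : Prop`), so
that the stub helper files `Theorems/HyperoctahedralRPExistsScaleCovariantLimitDecimation<Stub>.lean` (each proving
`theorem <stubName> : Sig.<stubName>` by name, `--supports stmt-CriticalPhenomena-1981`) and the closing skeleton
share ONE copy of every object. NOTHING in this file is asserted: every `def … : Prop` is a statement to be
proved by a registered stub or by the skeleton's glue; `PathLipschitz 2` / `PathLipschitz 3` are the line's
load-bearing CONJECTURE (local universality with a rate along the critical curve) and are open.

Skeleton v2 (lead c8) differs from the planner's v1 in three places, all to make the provable stubs independent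
and sufficient for the glue: (i) `EndpointIdentity p` is stated for EVERY volume `N` (sublattice box
`Λ_N ∩ pℤ³ = p · Λ_{⌊N/p⌋}`), not only `N = pM`, because `subPair`/`Jcrit` take `limUnder` over all `N`;
(ii) the bridge `BoxBridge` between `PairIsing.gibbsAvg` on the n.n. box couplings and the tree's
`isingExpect … .free` is a stub of its own (the planner's `FreeBoxLimit` is then GLUE over the tree theorem
`criticalCorr_wellDefined_holds`); (iii) `Sig.stub_curveEndpoints` takes (i) and (ii) as hypotheses.

Sources: L. P. Kadanoff, Physics 2 (1966) 263 (block spins / bond moving, read here as a homotopy in coupling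
space); S. Friedli, Y. Velenik, *Statistical Mechanics of Lattice Systems* (CUP 2017) §3.1–§3.8 (finite-volume
Gibbs averages, GKS, `β_c`, susceptibility); M. Aizenman, H. Duminil-Copin, V. Sidoravicius, CMP 334 (2015)
(`m*(β_c) = 0`, the critical state is well defined); crux idea card `Ideas/decimation-homotopy-rate.md`.
-/

noncomputable section

namespace Summit.CriticalPhenomena.Ising3DConformalLimit.Cruxes.ExistsScaleCovariantLimit.DecimationHomotopyRate

open Literature.Probability.LatticeModels Filter Set
open scoped Topology BigOperators
open Classical

/-! ## §0 Vocabulary: the two-coupling (nearest-neighbour `K` + sublattice range-`p` `J`) ferromagnet -/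

/-- Nearest-neighbour step of `ℤ³`: `v = ± eᵢ`. -/
def IsNN (v : Site 3) : Prop := ∃ i : Fin 3, v = Pi.single i 1 ∨ v = -Pi.single i 1

/-- Range-`p` axis step `v = ± p eᵢ`. -/
def IsAxisStep (p : ℕ) (v : Site 3) : Prop :=
  ∃ i : Fin 3, v = Pi.single i (p : ℤ) ∨ v = -Pi.single i (p : ℤ)

/-- `x` lies on the sublattice `p ℤ³`. -/
def OnSub (p : ℕ) (x : Site 3) : Prop := ∀ i : Fin 3, (p : ℤ) ∣ x i

/-- The two-coupling ferromagnet on the box `Λ_N = {-N,…,N}³` (free boundary condition), as an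
ordered-pair coupling matrix for `PairIsing.gibbsAvg`: `K/2` on nearest-neighbour pairs, `J/2` on pairs
`(x, x ± p eᵢ)` with BOTH ends on `pℤ³` (so the unordered n.n. bond carries `K` and the sublattice range-`p`
bond carries `J`), `0` otherwise. At `J = 0` it is the homogeneous n.n. model at `K`; at `K = 0` the sublattice
spins form the n.n. model on `pℤ³ ≅ ℤ³` at `J` and all other spins are free (`EndpointIdentity`). Kadanoff's
bond-moving family read as a HOMOTOPY in coupling space. -/
def decimationCoupling (p N : ℕ) (K J : ℝ) : ↥(box 3 N) → ↥(box 3 N) → ℝ := fun a b =>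
  if IsNN (b.1 - a.1) then K / 2
  else if OnSub p a.1 ∧ OnSub p b.1 ∧ IsAxisStep p (b.1 - a.1) then J / 2 else 0

/-- The homogeneous nearest-neighbour coupling `β` on the box `Λ_N` (free boundary condition): `β/2` on each
ORDERED nearest-neighbour pair, so that the unordered bond carries `β`. -/
def nnCoupling (N : ℕ) (β : ℝ) : ↥(box 3 N) → ↥(box 3 N) → ℝ := fun a b =>
  if IsNN (b.1 - a.1) then β / 2 else 0

/-- Spin monomial of lattice sites read inside the box `Λ_N` (junk factor `1` for a site outside the box;
every statement below uses it only where, or eventually where, all sites are inside). -/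
def boxMonomial (N : ℕ) {n : ℕ} (x : Fin n → Site 3) (σ : SpinConfig ↥(box 3 N)) : ℝ :=
  ∏ i, if h : x i ∈ box 3 N then spinAt (⟨x i, h⟩ : ↥(box 3 N)) σ else 1

/-- Finite-volume Gibbs average `⟨∏ᵢ σ_{xᵢ}⟩_{Λ_N; K, J}` of a spin monomial in the two-coupling model. -/
def boxAvg (p N : ℕ) (K J : ℝ) {n : ℕ} (x : Fin n → Site 3) : ℝ :=
  PairIsing.gibbsAvg (decimationCoupling p N K J) (boxMonomial N x)

/-- Infinite-volume (free b.c., `limUnder` over ALL volumes `N`, junk if divergent) sublattice pair function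
`x ↦ ⟨σ₀ σ_{p x}⟩_{K,J}`. -/
def subPair (p : ℕ) (K J : ℝ) (x : Site 3) : ℝ :=
  limUnder atTop fun N : ℕ => boxAvg p N K J ![0, (p : ℤ) • x]

/-- The CRITICAL CURVE as a graph over the n.n. coupling: `J_χ(K) = inf {J ≥ 0 : x ↦ ⟨σ₀σ_{px}⟩_{K,J} is not
summable}` (susceptibility threshold of the sublattice spins; `sInf ∅ = 0`). -/
def Jcrit (p : ℕ) (K : ℝ) : ℝ :=
  sInf {J : ℝ | 0 ≤ J ∧ ¬ Summable (subPair p K J)}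

/-- The axis pair `(0, m e₀)` as a `2`-configuration of `ℤ³`. -/
def axisPair (m : ℕ) : Fin 2 → Site 3 := ![0, Pi.single 0 (m : ℤ)]

/-- **Finite-volume PINNED SUBLATTICE ZOOM** at block scale `L` (sublattice units) in the volume `Λ_N`:
`P^N_{K,J}(L; z) = ⟨σ₀ σ_{pL e₀}⟩^{-n/2} · ⟨∏ᵢ σ_{pL zᵢ}⟩` for an integer configuration `z ∈ (ℤ³)ⁿ` — the
normalisation-free ratios whose `K`-independence along the critical curve is the load-bearing claim.
(Real power `Real.rpow`; junk while `⟨σ₀σ_{pLe₀}⟩_{Λ_N} = 0`, i.e. for `N < pL`; only `N ≥ N₀(L)` is used.) -/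
def finZoom (p N : ℕ) (K J : ℝ) (n L : ℕ) (z : Fin n → Site 3) : ℝ :=
  ((boxAvg p N K J (axisPair (p * L))) ^ (-(1 / 2 : ℝ))) ^ n *
    boxAvg p N K J (fun i => ((p * L : ℕ) : ℤ) • z i)

/-- The pinned zoom of the critical n.n. model ITSELF at the integer mesh `1/m` and the integer configuration
`z`: `Z(m; z) = ⟨σ₀σ_{m e₀}⟩_{β_c}^{-n/2} ⟨∏ᵢ σ_{m zᵢ}⟩_{β_c}` (equal to the tree's
`rescaledCorrelator (criticalCorr 3) rhoPin n (1/m) z`, proved in the skeleton). -/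
def latticeZoom (n m : ℕ) (z : Fin n → Site 3) : ℝ :=
  ((criticalTwoPoint 3 (Pi.single 0 (m : ℤ))) ^ (-(1 / 2 : ℝ))) ^ n *
    criticalCorr 3 n (fun i => (m : ℤ) • z i)

/-! ## §1 The statements of the line (plain `Prop`s; nothing asserted) -/

/-- **ENDPOINT IDENTITY** (the `K = 0` end of the path IS the coarser mesh; exact finite-volume identity,
provable now): at `K = 0` the free spins off `pℤ³` integrate out of numerator and denominator,
`Λ_N ∩ pℤ³ = p · Λ_{⌊N/p⌋}` and `IsAxisStep p (p•b − p•a) ↔ IsNN (b − a)`, so the correlations of the sublattice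
spins `p·xᵢ` in `Λ_N` at couplings `(0, J)` equal those of the homogeneous n.n. model at coupling `J` in
`Λ_{⌊N/p⌋}` at the sites `xᵢ` (both sides junk-consistent for sites outside the boxes: `p•xᵢ ∈ Λ_N ↔
xᵢ ∈ Λ_{⌊N/p⌋}`). Stated for EVERY volume `N` (v2). Guard `2 ≤ p` in the stub (at `p = 1` the two bond classes
coincide and the n.n. branch of `decimationCoupling` wins). A statement, not asserted. -/
def EndpointIdentity (p : ℕ) : Prop :=
  ∀ (N : ℕ) (J : ℝ) (n : ℕ) (x : Fin n → Site 3),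
    boxAvg p N 0 J (fun i => (p : ℤ) • x i) =
      PairIsing.gibbsAvg (nnCoupling (N / p) J) (boxMonomial (N / p) x)

/-- **BOX BRIDGE** (provable now): on the box `Λ_N` with free boundary condition, the pair-coupling Gibbs
average of a spin monomial whose sites all lie in the box, taken with the coupling matrix `nnCoupling N β`
(`β/2` per ordered n.n. pair), IS the tree's finite-volume Ising expectation
`isingExpect (zdGraph 3) (box 3 N) β 0 .free (spinMonomial x)` (same Boltzmann weight
`exp(β Σ_{edges in Λ_N} σσ)`: `integral_isingMeasure`, ordered pairs versus bonds). A statement, not asserted. -/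
def BoxBridge : Prop :=
  ∀ (N : ℕ) (β : ℝ) (n : ℕ) (x : Fin n → Site 3), (∀ i, x i ∈ box 3 N) →
    PairIsing.gibbsAvg (nnCoupling N β) (boxMonomial N x) =
      isingExpect (zdGraph 3) (box 3 N) β 0 .free (spinMonomial x)

/-- **FREE BOX LIMIT AT `β_c`** (glue in the skeleton, from `BoxBridge` and the tree theorem
`criticalCorr_wellDefined_holds`): the free-boundary-condition box Gibbs averages of spin monomials of the n.n.
model at `β_c(3)` converge to the critical state `criticalCorr 3`. A statement, not asserted. -/
def FreeBoxLimit : Prop :=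
  ∀ (n : ℕ) (x : Fin n → Site 3),
    Tendsto (fun N : ℕ => PairIsing.gibbsAvg (nnCoupling N (criticalBeta 3)) (boxMonomial N x)) atTop
      (𝓝 (criticalCorr 3 n x))

/-- **CURVE ENDPOINTS** (known type): the critical curve joins `(K,J) = (0, β_c)` to `(β_c, 0)`.
`J_χ(0) = β_c`: at `K = 0` the sublattice pair function is the FREE n.n. two-point function at `β = J`
(endpoint identity + box bridge + GKS box limit), summable iff `J < β_c` (sharpness:
`susceptibility_lt_top_of_lt_criticalBeta`, `susceptibility_eq_top_of_criticalBeta_le`). `J_χ(β_c) = 0`: at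
`(β_c, 0)` the sublattice pair function is `criticalTwoPoint 3 (p•x) ≥ c p⁻²‖x‖⁻²` (free = plus at `β_c`,
`criticalTwoPoint_bounds_holds`), not summable over `ℤ³`, and the defining set lies in `[0, ∞)`.
A statement, not asserted. -/
def CurveEndpoints (p : ℕ) : Prop :=
  Jcrit p 0 = criticalBeta 3 ∧ Jcrit p (criticalBeta 3) = 0

/-- **PATH LIPSCHITZ = LOCAL UNIVERSALITY WITH A RATE ALONG THE CRITICAL CURVE (load-bearing conjecture,
the card's K1 in pinned finite-volume form).** For every order `n` and INJECTIVE integer configuration `z`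
there are `θ > 0` and `C` such that for every block scale `L ≥ 1` and every two points `(K, J_χ(K))`,
`(K', J_χ(K'))` of the critical curve, for all volumes `N ≥ N₀(L, K, K')`, the finite-volume pinned sublattice
zooms differ by at most `C · L^{-θ} · [ |K − K'| + |J_χ(K) − J_χ(K')| ]`. Why it might fail: a marginal or
relevant even `O_h`-scalar besides `ε` somewhere on the curve gives `θ = 0`; the statement is an irrelevance
estimate at `ε = 1` (`RigorousRGSmallParameter` bites in spirit). OPEN. A statement, not asserted. -/
def PathLipschitz (p : ℕ) : Prop :=
  ∀ (n : ℕ) (z : Fin n → Site 3), Function.Injective z → ∃ θ : ℝ, 0 < θ ∧ ∃ C : ℝ, ∀ L : ℕ, 1 ≤ L →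
    ∀ K ∈ Set.Icc (0 : ℝ) (criticalBeta 3), ∀ K' ∈ Set.Icc (0 : ℝ) (criticalBeta 3),
      ∃ N₀ : ℕ, ∀ N : ℕ, N₀ ≤ N →
        |finZoom p N K (Jcrit p K) n L z - finZoom p N K' (Jcrit p K') n L z| ≤
          C * (L : ℝ) ^ (-θ) * (|K - K'| + |Jcrit p K - Jcrit p K'|)

/-- **First support target (NOT a registered stub; the infinitesimal shadow of `PathLipschitz p` at the n.n.
end):** there is a slope `s > 0` (`= −J_χ'(β_c)`, numerically `5.14(1)` for `p = 2`) such that the finite-volume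
response of every pinned sublattice zoom to the `ε`-NEUTRAL tangent `T = −Σ_nn σσ + s Σ_sub σσ` at
`(K,J) = (β_c, 0)` is `O(L^{-θ})` uniformly in the volume. A statement, not asserted. -/
def NNEndTangentBound (p : ℕ) : Prop :=
  ∃ s : ℝ, 0 < s ∧ ∀ (n : ℕ) (z : Fin n → Site 3), Function.Injective z →
    ∃ θ : ℝ, 0 < θ ∧ ∃ C : ℝ, ∀ L : ℕ, 1 ≤ L →
    ∃ N₀ : ℕ, ∀ N : ℕ, N₀ ≤ N →
      |deriv (fun t : ℝ => finZoom p N (criticalBeta 3 - t) (s * t) n L z) 0| ≤ C * (L : ℝ) ^ (-θ)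

/-! ## §2 Stub STATEMENTS `Sig.stub_*` (each a `def … : Prop`; nothing asserted here) -/

/-- **STUB E statement** — the endpoint identity for every period `p ≥ 2` and every volume (provable now, M). -/
def Sig.stub_endpointIdentity : Prop := ∀ p : ℕ, 2 ≤ p → EndpointIdentity p

/-- **STUB B statement** — the box bridge `PairIsing.gibbsAvg (nnCoupling N β) = isingExpect … .free` on spin
monomials inside the box (provable now, M). -/
def Sig.stub_boxBridge : Prop := BoxBridge

/-- **STUB C statement** — the curve endpoints `J_χ(0) = β_c(3)`, `J_χ(β_c(3)) = 0` for every `p ≥ 2`, GIVEN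
the endpoint identity and the box bridge (known type, M/L: sharpness of the n.n. model, `free = plus` at `β_c`,
the Simon–Lieb lower bound, all in tree). -/
def Sig.stub_curveEndpoints : Prop :=
  (∀ p : ℕ, 2 ≤ p → EndpointIdentity p) → BoxBridge → ∀ p : ℕ, 2 ≤ p → CurveEndpoints p

/-- **STUB P₂ statement** — path Lipschitz along the critical curve of the period-`2` family (LOAD-BEARING, open). -/
def Sig.stub_pathLipschitz2 : Prop := PathLipschitz 2

/-- **STUB P₃ statement** — path Lipschitz along the critical curve of the period-`3` family (LOAD-BEARING, open). -/
def Sig.stub_pathLipschitz3 : Prop := PathLipschitz 3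

/-! ## §2b Elementary glue facts shared by the skeleton and the stub files (registered sub-goal `glue_decimationFacts`) -/

/-- GLUE FACTS statement (elementary bookkeeping, proved below): (1) at `J = 0` the two-coupling matrix is the
homogeneous n.n. matrix; (2) hence `boxAvg p N K 0` is the n.n. box average; (3) `p • (0, m e₀) = (0, pm e₀)`;
(4) `p • (L • z) = (pL) • z`. -/
def Sig.glue_decimationFacts : Prop :=
  (∀ (p N : ℕ) (K : ℝ), decimationCoupling p N K 0 = nnCoupling N K) ∧
  (∀ (p N : ℕ) (K : ℝ) (n : ℕ) (x : Fin n → Site 3),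
      boxAvg p N K 0 x = PairIsing.gibbsAvg (nnCoupling N K) (boxMonomial N x)) ∧
  (∀ p m : ℕ, (fun i => (p : ℤ) • axisPair m i) = axisPair (p * m)) ∧
  (∀ (p L n : ℕ) (z : Fin n → Site 3),
      (fun i => (p : ℤ) • ((L : ℤ) • z i)) = fun i => ((p * L : ℕ) : ℤ) • z i)

/-- At `J = 0` the two-coupling model is the homogeneous n.n. model. [folklore] -/
theorem decimationCoupling_zero_J (p N : ℕ) (K : ℝ) : decimationCoupling p N K 0 = nnCoupling N K := by
  funext a b
  simp only [decimationCoupling, nnCoupling, zero_div, ite_self]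

/-- `boxAvg` at `J = 0` is the free n.n. box average. [folklore] -/
theorem boxAvg_zero_J (p N : ℕ) (K : ℝ) {n : ℕ} (x : Fin n → Site 3) :
    boxAvg p N K 0 x = PairIsing.gibbsAvg (nnCoupling N K) (boxMonomial N x) := by
  rw [boxAvg, decimationCoupling_zero_J]

/-- `p • (0, m e₀) = (0, pm e₀)`. [folklore] -/
theorem smul_axisPair (p m : ℕ) : (fun i => (p : ℤ) • axisPair m i) = axisPair (p * m) := by
  funext i j
  fin_cases i
  · simp [axisPair]
  · simp only [axisPair, Fin.mk_one, Matrix.cons_val_one, Matrix.cons_val_fin_one, Pi.smul_apply,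
      smul_eq_mul, Pi.single_apply, Nat.cast_mul]
    split_ifs <;> simp

/-- `p • (L • z) = (pL) • z`. [folklore] -/
theorem smul_smul_cfg (p L : ℕ) {n : ℕ} (z : Fin n → Site 3) :
    (fun i => (p : ℤ) • ((L : ℤ) • z i)) = fun i => ((p * L : ℕ) : ℤ) • z i := by
  funext i
  rw [smul_smul, Nat.cast_mul]

/-- The registered glue sub-goal `glue_decimationFacts` (elementary; items (1)–(4) above). [folklore] -/
theorem glue_decimationFacts : Sig.glue_decimationFacts :=
  ⟨decimationCoupling_zero_J, fun p N K _ x => boxAvg_zero_J p N K x, smul_axisPair,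
    fun p L _ z => smul_smul_cfg p L z⟩

end Summit.CriticalPhenomena.Ising3DConformalLimit.Cruxes.ExistsScaleCovariantLimit.DecimationHomotopyRate

end
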